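import Summits.KontsevichZagierPeriods.KontsevichZagierPeriods.Theorems.LinRedNormalFormHoffmanSpanInKZDerived

/-!
# Crux `LinRedNormalForm.HoffmanSpanInKZ` (stmt-KontsevichZagierPeriods-15044), line `Sketch`:
# coverage of the admissible words by a word table, decided over word LISTS (registered stub `stub_cover`)

The assembly lemma `edsCertificate_of_dwtables'` asks that every admissible `ε : Fin N → Bool` be the word
of some row of the word table.  Deciding this over the function type `Fin N → Bool` (as the weight-`≤ 10`
files do) enumerates `2^N` functions built by `Fintype.piFinset`; this file decides it over the explicit
list `allWords N` of the `2^N` words-as-lists instead (`cover_of_allWords`), reading a list back as a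
function through `wordOf` (`wordOf_ofFn`).

Sources: the reflection set-up of `MzvKernelInKZTwoPosetsEdsCertificateLow` (this tree). [folklore]
-/

namespace Summit.KontsevichZagierPeriods.LinRedNormalForm.HoffmanSpanInKZ

open Literature.NumberTheory.Transcendental
open Summit.KontsevichZagierPeriods.MzvKernelInKZ.Negative
open Summit.KontsevichZagierPeriods.MzvKernelInKZ.TwoPosets

/-- All words of length `n`, as lists of letters. [folklore] -/
def allWords : ℕ → List (List Bool)
  | 0 => [[]]
  | n + 1 => (allWords n).flatMap fun l => [false :: l, true :: l]

/-- Every list of letters occurs in `allWords` of its length. [folklore] -/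
theorem mem_allWords : ∀ l : List Bool, l ∈ allWords l.length
  | [] => by simp [allWords]
  | b :: l => by
    simp only [List.length_cons, allWords, List.mem_flatMap, List.mem_cons, List.not_mem_nil, or_false]
    refine ⟨l, mem_allWords l, ?_⟩
    cases b <;> simp

/-- **Coverage through `allWords`**: if every word-as-list of length `N` whose read-back `wordOf N l` is
admissible occurs among the binary words of the rows of `T`, then every admissible `ε` is the word of some
row. [folklore] -/
theorem cover_of_allWords (N : ℕ) (T : List WRow)
    (h : (allWords N).all (fun l => decide (Adm (wordOf N l) → l ∈ T.map fun c => MZV.binaryWord c.w)) =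
      true) :
    ∀ ε : Fin N → Bool, Adm ε → ∃ c ∈ T, bword N c.w = ε := by
  refine wcover_of_lists N T fun ε hε => ?_
  have hl : List.ofFn ε ∈ allWords N := by simpa using mem_allWords (List.ofFn ε)
  have := of_decide_eq_true ((List.all_eq_true.1 h) _ hl)
  rw [wordOf_ofFn] at this
  exact this hε

/-! ## The registered stub -/

/-- Coverage decided over word lists, as a statement about this file's `allWords` (not a published fact). -/
def CoverSound : Prop :=
  ∀ (N : ℕ) (T : List WRow),
    (allWords N).all (fun l => decide (Adm (wordOf N l) → l ∈ T.map fun c => MZV.binaryWord c.w)) = true →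
      ∀ ε : Fin N → Bool, Adm ε → ∃ c ∈ T, bword N c.w = ε

/-- **Registered stub `stub_cover`** of the skeleton of line `Sketch`. -/
theorem stub_cover : CoverSound := cover_of_allWords

/-- Smoke test (kernel), weight `4`: the four rows of the Derived file's smoke test cover the admissible
words. -/
example : (allWords 4).all (fun l => decide (Adm (wordOf 4 l) →
    l ∈ ([⟨[2, 2], [], [([2, 2], 1, 1)], []⟩, ⟨[4], [], [([2, 2], 4, 3)], [(1, 4, 3)]⟩,
      ⟨[3, 1], [([4], 1, 4)], [], [(0, 1, 4)]⟩, ⟨[2, 1, 1], [([4], 1, 1)], [], [(2, 1, 1)]⟩] : List WRow).map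
        fun c => MZV.binaryWord c.w)) = true := by
  decide +kernel

end Summit.KontsevichZagierPeriods.LinRedNormalForm.HoffmanSpanInKZ
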